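import Summits.QuantumFields.YangMills.Theorems.BalabanUVNodesN09LocalSupportSetAtRecord
import Literature.MathematicalPhysics.QuantumFieldTheory.Balaban1983to89.Node00.SmallFieldChi29SelOfRecord

/-!
# NODE N09 [B12] · THE LOCAL SUPPORT SET OF ROAD B FOR AN ARBITRARY CRITICAL LETTER: the p. 266–267 rider, the strict threshold hierarchy and FILE 1's local support clause
# with the minimiser selection `W ↦ V^{(k)}(W)` a PARAMETER — fed by the fibre identity `Ū(V^{(k)}(W)) = W` and [B7] Prop-2 smallness of `V^{(k)}(W)` on the domain, DISPLAYED

Cell `pub-ymgap` (YM-PLAN Track A), DAG node N09 [Balaban1987RG1] (= [I]); width seat `pub-ymgap-dag-n09-w3` g6, FILE 4; count-neutral helper keyed to K1⁹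
`StabilityBRunRowsAtRecordR13SepCoPHV` = stmt-QuantumFields-27364 (`--kind proof --supports … --as helper`).

WHY.  FILE 2 (`…N09LocalSupportSetAtRecord`) proves the local support clause for the BARE-CHOICE record through dag-n09-w4 g3's rider `hb0_of_hsolν_of_numerics`, which reads
node00-def-B's `Uk` (fibre identity `avg_critCfgOfRecord`, Prop-2 smallness `hcrit_of_ukExists`).  FILE 3 made the road-B ENGINE selection-generic; THIS FILE does the same for
the SUPPORT SET: the rider behind `hb0` is lit-balaban's `B12B0RestrictionNonlinear267.norm_pertVar_b0_le_pow`, a statement about ANY fine field `V` with the same average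
as `U` at `c`, small loops, and `U` `ε₁`-close to `V` off `b₀(c)` — so for an arbitrary letter `crit : (coarse) → (fine)` the two facts it needs about `V := crit(Ū U)` are
exactly (fibre identity) `Ū(crit W) = W` and (Prop 2) `PlaqSmall δ (crit W)` at `W = Ū U`, DISPLAYED here as hypotheses on an open set `D` of coarse fields (theorems for the bare
choice on the solvable set — `avg_critCfgOfRecord`, `plaqSmall_critCfgOfRecord_of_ukExists`; for the offer `critCfgSelOfRecord` the identity is `avg_critCfgSelOfRecord`, the
smallness is K0c∕w4 g2's displayed `hcrit`).  Result: for every density `ρ` supported inside the threshold set of `crit` («`∀ b ∉ b₀, dist1 (crit(Ū U)(b)⁻¹·U(b)) < ε₁`»),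
FILE 1∕FILE 3's local support clause `Ū U ∈ D → ρ U ≠ 0 → U ∈ interior «loops ≤ α ∧ plaquettes ≤ B»`, `B := δ + 4·max(ε₁, 10·((d+2)L)·L^{d−1}·ε₁)`, from numerics alone.

WHAT IS PROVED (theorems only; 0 def, 0 sorry; axioms standard).
§1 ★★ `dist1_b0_le_of_thresholds` (the rider for an arbitrary letter), ★ `plaqHol_lt_of_thresholds` (strict hierarchy), `loopHol_le_of_thresholds`.
§2 ★★★ `mem_interior_localSupportSet_of_thresholds`, ★★★ `hρK_of_thresholds` (FILE 1∕3's `hρK` for every `ρ` supported in the threshold set of `crit`, over an open `D` on which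
   `crit` has the fibre identity and `δ`-small plaquettes).
§3 editions: `hρK_chi29_bare_of_hsolν` (bare: FILE 2's clause recovered from `hsolν` + [B7]-numerics, sanity instance) · `plaqSmall_critCfgSelOfRecord_of_ukExists`,
   `hcritSel_of_ukExists` ([B7] Prop-2 smallness of the OFFER's critical configuration on the solvable set — the Sel twins of dag-n09-w1 g2's faces, via K0c's
   `isBackground_UkSel` + dag-n21-c's `plaqSmall_iter_avOfRecord_level`) · ★★ `hρK_betaInput_chi29Sel_of_fibre_of_plaqSmall` (Sel offer, Prop-2 smallness displayed) ·
   ★★★ `hρK_betaInput_chi29Sel_of_hsolν_of_numerics` (Sel offer from `hsolν` + numerics ONLY — the exact Sel twin of FILE 2's clause).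

HONEST SCOPE ∕ FRAMING.  LOCATED, count-neutral kernel bookkeeping BY NAME (lit-balaban's nonlinear rider, the tree's Stokes bound, K0e∕K0c threshold faces, FILE 2 §1); the fibre
identity ∕ Prop-2 smallness of the letter, `hsolν`, numerics DISPLAYED, asserted of NO record; NO record edition made or proposed; NOTHING of Bałaban's asserted; `hreg`∕(F3)∕`contTOn`
NOT discharged; N09 NOT discharged; conjunct 1 (Lemma 4) ∕ FLAG №7 untouched; K0⁷ ∕ K1⁹ ∕ K2⁹ ∕ K3⁸ NOT closed; counts unmoved (typed 28∕28 · discharged 5∕28); one finite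
four-torus programme at fixed `ε = L^{−K}` per run — R4 closes the conditional rung `BalabanLadder.UV` only; NOT ℝ⁴ ∕ infinite volume ∕ OS; the Yang–Mills mass gap (Clay) is
NOT proved by any of this.
-/

noncomputable section

open scoped Matrix.Norms.L2Operator Topology
open Filter Set Function MeasureTheory

namespace Summit.QuantumFields.YangMills.BalabanUVNodes.N09LocalSupportSetAnyCrit

open Literature.MathematicalPhysics.QuantumFieldTheory.Balaban1983to89
open Literature.MathematicalPhysics.QuantumFieldTheory.Balaban1983to89.T4Continuum (T4Family)
open Literature.MathematicalPhysics.QuantumFieldTheory.Balaban1983to89.Node00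
open Literature.MathematicalPhysics.QuantumFieldTheory.Balaban1983to89.BlockAveraging (Idx loopHol avgFun)
open Literature.MathematicalPhysics.QuantumFieldTheory.Balaban1983to89.ExpMeanLog (deltaSU expMeanLogSU)
open Literature.MathematicalPhysics.QuantumFieldTheory.Balaban1983to89.T4TiltOscillation (bdev)
open Literature.MathematicalPhysics.QuantumFieldTheory.Balaban1983to89.T4ExpWindowSmallField (plaqDev dist1_plaqHol_le_add plaqDev_le_four_mul)
open Literature.MathematicalPhysics.QuantumFieldTheory.Balaban1983to89.B12SmallFieldDomain259 (b0)
open Literature.MathematicalPhysics.QuantumFieldTheory.Balaban1983to89.B12B0RestrictionNonlinear267 (norm_pertVar_b0_le_pow dist1_inv_mul_eq_norm_pertVar)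
open Summit.QuantumFields.YangMills.BalabanUVNodes.N09NestingOfHierAxial (hcrit_of_ukExists pow_mul_eta_le_inv)
open Summit.QuantumFields.YangMills.Theorems.N21AveragedDatumRegularity (plaqSmall_iter_avOfRecord_level)
open Summit.QuantumFields.YangMills.BalabanUVNodes.N09TransportPositiveOnDomainOfFibredChart (betaInput_chi29_pos_iff betaInput_chi29_nonneg)
open Summit.QuantumFields.YangMills.BalabanUVNodes.N09LocalSupportSetAtRecord (mem_interior_loopLe_inter_plaqLe)

variable {F : T4Family} {N : ℕ} [NeZero N] {K k : ℕ}

/-! ## §1 The rider and the strict threshold hierarchy for an arbitrary letter -/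

/-- ★★ **THE p. 266–267 RIDER FOR AN ARBITRARY CRITICAL LETTER** (lit-balaban's `norm_pertVar_b0_le_pow` at `V := crit(Ū U)`): for `k < K`, if `crit(Ū U)` lies in the fibre
over `Ū U` and has `δ`-small plaquettes, and `U` is `ε₁`-close to it at every non-distinguished bond, then at every distinguished bond `b₀(c)`
`dist1 (crit(Ū U)(b₀(c))⁻¹·U(b₀(c))) ≤ 10·((d+2)L)·L^{d−1}·ε₁` — under the rider's numerics `1640·(2ℓε₁ + (ℓ²∕4)δ)·L^{2(d−1)} ≤ 1`, `13·(…)·L^{d−1} < δ_N` (`ℓ = (d+2)L`).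
[cite: Balaban1987RG1, (2.9) p.266 and p.267; Balaban1985Averaging, Prop. 2 (53) p.26 and (19) p.21] -/
theorem dist1_b0_le_of_thresholds (crit : GaugeField (F.P K) (k + 1) (SU N) → GaugeField (F.P K) k (SU N)) (hk : k < K) {ε₁ δ : ℝ}
    (hε : 0 ≤ ε₁) (hδ : 0 ≤ δ)
    (hn1 : 1640 * (2 * (((((F.P K).d + 2) * (F.P K).L : ℕ) : ℝ) * ε₁) + ((((F.P K).d + 2) * (F.P K).L : ℕ) : ℝ) ^ 2 / 4 * δ) *
      (((F.P K).L : ℝ) ^ ((F.P K).d - 1)) ^ 2 ≤ 1)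
    (hn2 : 13 * (2 * (((((F.P K).d + 2) * (F.P K).L : ℕ) : ℝ) * ε₁) + ((((F.P K).d + 2) * (F.P K).L : ℕ) : ℝ) ^ 2 / 4 * δ) *
      ((F.P K).L : ℝ) ^ ((F.P K).d - 1) < deltaSU (Fin N))
    {U : GaugeField (F.P K) k (SU N)}
    (havg : (avOfRecord F N K k).avg (crit ((avOfRecord F N K k).avg U)) = (avOfRecord F N K k).avg U)
    (hcritδ : PlaqSmall δ (crit ((avOfRecord F N K k).avg U)))
    (hoff : ∀ b : PBond (F.P K) k, ¬ IsB0 b → dist1 ((crit ((avOfRecord F N K k).avg U) b)⁻¹ * U b) < ε₁) :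
    ∀ b : PBond (F.P K) k, IsB0 b →
      dist1 ((crit ((avOfRecord F N K k).avg U) b)⁻¹ * U b) ≤ 10 * (((((F.P K).d + 2) * (F.P K).L : ℕ) : ℝ) * ε₁) * ((F.P K).L : ℝ) ^ ((F.P K).d - 1) := by
  intro b hb
  obtain ⟨c, rfl⟩ := hb
  have hjr : k + 1 ≤ (F.P K).m + (F.P K).K := by simp only [T4Continuum.T4Family.P_K]; omega
  have hd : 2 ≤ (F.P K).d := by rw [T4Family.P_d]; norm_num
  set V := crit ((avOfRecord F N K k).avg U) with hV
  have hM : avgFun (expMeanLogSU (n := Fin N)) U c = avgFun (expMeanLogSU (n := Fin N)) V c := by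
    have h1 : (avOfRecord F N K k).avg V = (avOfRecord F N K k).avg U := havg
    rw [avOfRecord_avg] at h1
    exact (congrFun h1 c).symm
  have hF : ∀ b : PBond (F.P K) k, (∀ c' : PBond (F.P K) (k + 1), b ≠ b0 c') →
      ‖BlockAveragingEMLLinearisedBackground.pertVar V U b‖ ≤ ε₁ := by
    intro b hb
    have h := hoff b (fun ⟨c', hc'⟩ => hb c' hc'.symm)
    rw [dist1_inv_mul_eq_norm_pertVar] at h
    exact h.le
  have hloops : ∀ i, dist1 (loopHol V c i) ≤ ((((F.P K).d + 2) * (F.P K).L : ℕ) : ℝ) ^ 2 / 4 * δ :=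
    fun i => BlockAveragingEMLProp2.dist1_loopHol_le' hδ (fun q => (hcritδ q).le) c i
  have h := norm_pertVar_b0_le_pow hjr hd U V c hε hM hF hloops hn1 hn2
  rw [dist1_inv_mul_eq_norm_pertVar]
  exact h

/-- ★ **THE STRICT THRESHOLD HIERARCHY FOR AN ARBITRARY LETTER**: `U` `ε₁`-close to `crit(Ū U)` off `b₀`, `ε₁′`-close at `b₀`, `crit(Ū U)` with `δ`-small plaquettes ⇒ every plaquette of
`U` satisfies `|U(∂p) − 1| < δ + 4·max(ε₁, ε₁′)`. [cite: Balaban1987RG1, (2.9) p.266, p.267 and p.259; Balaban1988Convergent, p.265] -/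
theorem plaqHol_lt_of_thresholds (crit : GaugeField (F.P K) (k + 1) (SU N) → GaugeField (F.P K) k (SU N)) {ε₁ ε₁' δ : ℝ}
    {U : GaugeField (F.P K) k (SU N)}
    (hoff : ∀ b : PBond (F.P K) k, ¬ IsB0 b → dist1 ((crit ((avOfRecord F N K k).avg U) b)⁻¹ * U b) < ε₁)
    (hb0 : ∀ b : PBond (F.P K) k, IsB0 b → dist1 ((crit ((avOfRecord F N K k).avg U) b)⁻¹ * U b) ≤ ε₁')
    (hcritδ : PlaqSmall δ (crit ((avOfRecord F N K k).avg U))) (p : Plaq (F.P K) k) :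
    dist1 (GaugeField.plaqHol U p) < δ + 4 * max ε₁ ε₁' := by
  set V₀ := crit ((avOfRecord F N K k).avg U)
  have hb : ∀ b, dist1 (bdev U V₀ b) ≤ max ε₁ ε₁' := by
    intro b
    by_cases h0 : IsB0 b
    · exact (hb0 b h0).trans (le_max_right _ _)
    · exact (le_of_lt (hoff b h0)).trans (le_max_left _ _)
  calc dist1 (GaugeField.plaqHol U p) ≤ dist1 (GaugeField.plaqHol V₀ p) + plaqDev U V₀ p := dist1_plaqHol_le_add U V₀ p
    _ < δ + 4 * max ε₁ ε₁' := add_lt_add_of_lt_of_le (hcritδ p) (plaqDev_le_four_mul hb p)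

/-- **… hence every plaquette of `U` is below `B := δ + 4·max(ε₁, 10ℓL^{d−1}ε₁)` and every (0.4) loop is `≤ (ℓ²∕4)·B`** (§1 rider + hierarchy + `LatticeWordStokes.dist1_loopHol_le`).
[cite: Balaban1987RG1, (0.4) p.253, (2.9) p.266, p.267 and p.259; Balaban1985Averaging, (19)–(20) p.21] -/
theorem loopHol_le_of_thresholds (crit : GaugeField (F.P K) (k + 1) (SU N) → GaugeField (F.P K) k (SU N)) (hk : k < K) {ε₁ δ : ℝ}
    (hε : 0 ≤ ε₁) (hδ : 0 ≤ δ)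
    (hn1 : 1640 * (2 * (((((F.P K).d + 2) * (F.P K).L : ℕ) : ℝ) * ε₁) + ((((F.P K).d + 2) * (F.P K).L : ℕ) : ℝ) ^ 2 / 4 * δ) *
      (((F.P K).L : ℝ) ^ ((F.P K).d - 1)) ^ 2 ≤ 1)
    (hn2 : 13 * (2 * (((((F.P K).d + 2) * (F.P K).L : ℕ) : ℝ) * ε₁) + ((((F.P K).d + 2) * (F.P K).L : ℕ) : ℝ) ^ 2 / 4 * δ) *
      ((F.P K).L : ℝ) ^ ((F.P K).d - 1) < deltaSU (Fin N))
    {U : GaugeField (F.P K) k (SU N)}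
    (havg : (avOfRecord F N K k).avg (crit ((avOfRecord F N K k).avg U)) = (avOfRecord F N K k).avg U)
    (hcritδ : PlaqSmall δ (crit ((avOfRecord F N K k).avg U)))
    (hoff : ∀ b : PBond (F.P K) k, ¬ IsB0 b → dist1 ((crit ((avOfRecord F N K k).avg U) b)⁻¹ * U b) < ε₁) :
    (∀ p : Plaq (F.P K) k, dist1 (GaugeField.plaqHol U p) <
        δ + 4 * max ε₁ (10 * (((((F.P K).d + 2) * (F.P K).L : ℕ) : ℝ) * ε₁) * ((F.P K).L : ℝ) ^ ((F.P K).d - 1))) ∧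
      ∀ c (i : Idx (F.P K)), dist1 (loopHol U c i) ≤ ((((F.P K).d + 2) * (F.P K).L : ℕ) : ℝ) ^ 2 / 4 *
        (δ + 4 * max ε₁ (10 * (((((F.P K).d + 2) * (F.P K).L : ℕ) : ℝ) * ε₁) * ((F.P K).L : ℝ) ^ ((F.P K).d - 1))) := by
  have hplaq : ∀ p : Plaq (F.P K) k, dist1 (GaugeField.plaqHol U p) <
      δ + 4 * max ε₁ (10 * (((((F.P K).d + 2) * (F.P K).L : ℕ) : ℝ) * ε₁) * ((F.P K).L : ℝ) ^ ((F.P K).d - 1)) :=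
    plaqHol_lt_of_thresholds crit hoff (dist1_b0_le_of_thresholds crit hk hε hδ hn1 hn2 havg hcritδ hoff) hcritδ
  have hB : 0 ≤ δ + 4 * max ε₁ (10 * (((((F.P K).d + 2) * (F.P K).L : ℕ) : ℝ) * ε₁) * ((F.P K).L : ℝ) ^ ((F.P K).d - 1)) :=
    add_nonneg hδ (mul_nonneg (by norm_num) (hε.trans (le_max_left _ _)))
  exact ⟨hplaq, fun c i => LatticeWordStokes.dist1_loopHol_le hB hplaq c i⟩

/-! ## §2 FILE 1∕3's local support clause for an arbitrary letter -/

/-- ★★★ **THE SUPPORT OVER `D` LIES IN THE INTERIOR OF «loops `≤ α` ∧ plaquettes `≤ B`», FOR AN ARBITRARY LETTER.**  `D` a set of coarse fields on which `crit` has the fibre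
identity `Ū(crit W) = W` and `δ`-small plaquettes; `U` with `Ū U ∈ D` and all non-distinguished thresholds of `crit` inactive-below (`< ε₁`); numerics (rider's two,
`(ℓ²∕4)·B < α`, `0 ≤ ε₁`, `0 ≤ δ`) ⇒ `U ∈ interior {W | (∀ c i, dist1 (loopHol W c i) ≤ α) ∧ ∀ p, |W(∂p) − 1| ≤ B}`, `B = δ + 4·max(ε₁, 10ℓL^{d−1}ε₁)`.
[cite: Balaban1987RG1, (0.4) p.253, p.259, (2.9) p.266 and p.267; Balaban1985Averaging, Prop. 2 (53) p.26 and (19) p.21] -/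
theorem mem_interior_localSupportSet_of_thresholds (crit : GaugeField (F.P K) (k + 1) (SU N) → GaugeField (F.P K) k (SU N)) (hk : k < K) {ε₁ δ : ℝ}
    (hε : 0 ≤ ε₁) (hδ : 0 ≤ δ)
    (hn1 : 1640 * (2 * (((((F.P K).d + 2) * (F.P K).L : ℕ) : ℝ) * ε₁) + ((((F.P K).d + 2) * (F.P K).L : ℕ) : ℝ) ^ 2 / 4 * δ) *
      (((F.P K).L : ℝ) ^ ((F.P K).d - 1)) ^ 2 ≤ 1)
    (hn2 : 13 * (2 * (((((F.P K).d + 2) * (F.P K).L : ℕ) : ℝ) * ε₁) + ((((F.P K).d + 2) * (F.P K).L : ℕ) : ℝ) ^ 2 / 4 * δ) *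
      ((F.P K).L : ℝ) ^ ((F.P K).d - 1) < deltaSU (Fin N))
    {α : ℝ} (hαB : ((((F.P K).d + 2) * (F.P K).L : ℕ) : ℝ) ^ 2 / 4 *
      (δ + 4 * max ε₁ (10 * (((((F.P K).d + 2) * (F.P K).L : ℕ) : ℝ) * ε₁) * ((F.P K).L : ℝ) ^ ((F.P K).d - 1))) < α)
    {D : Set (GaugeField (F.P K) (k + 1) (SU N))}
    (hfib : ∀ W ∈ D, (avOfRecord F N K k).avg (crit W) = W) (hcritδ : ∀ W ∈ D, PlaqSmall δ (crit W))
    {U : GaugeField (F.P K) k (SU N)} (hUD : (avOfRecord F N K k).avg U ∈ D)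
    (hoff : ∀ b : PBond (F.P K) k, ¬ IsB0 b → dist1 ((crit ((avOfRecord F N K k).avg U) b)⁻¹ * U b) < ε₁) :
    U ∈ interior {W : GaugeField (F.P K) k (SU N) | (∀ c i, dist1 (loopHol W c i) ≤ α) ∧ ∀ p, dist1 (GaugeField.plaqHol W p) ≤
      δ + 4 * max ε₁ (10 * (((((F.P K).d + 2) * (F.P K).L : ℕ) : ℝ) * ε₁) * ((F.P K).L : ℝ) ^ ((F.P K).d - 1))} := by
  obtain ⟨hplaq, hloop⟩ := loopHol_le_of_thresholds crit hk hε hδ hn1 hn2 (hfib _ hUD) (hcritδ _ hUD) hoff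
  exact mem_interior_loopLe_inter_plaqLe (fun c i => (hloop c i).trans_lt hαB) hplaq

/-- ★★★ **FILE 1∕3's LOCAL SUPPORT CLAUSE `hρK`, FOR AN ARBITRARY LETTER AND EVERY DENSITY SUPPORTED IN ITS THRESHOLD SET**: if `ρ U ≠ 0` forces every non-distinguished
threshold of `crit` at `U` below `ε₁` (the (2.9) cut-off of `crit` is a factor of `ρ`), then over every `D` as above
`∀ U, Ū U ∈ D → ρ U ≠ 0 → U ∈ interior «loops ≤ α ∧ plaquettes ≤ B»`. [cite: Balaban1987RG1, (0.19) p.255, p.259, (2.9) p.266 and p.267] -/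
theorem hρK_of_thresholds (crit : GaugeField (F.P K) (k + 1) (SU N) → GaugeField (F.P K) k (SU N)) (hk : k < K) {ε₁ δ : ℝ}
    (hε : 0 ≤ ε₁) (hδ : 0 ≤ δ)
    (hn1 : 1640 * (2 * (((((F.P K).d + 2) * (F.P K).L : ℕ) : ℝ) * ε₁) + ((((F.P K).d + 2) * (F.P K).L : ℕ) : ℝ) ^ 2 / 4 * δ) *
      (((F.P K).L : ℝ) ^ ((F.P K).d - 1)) ^ 2 ≤ 1)
    (hn2 : 13 * (2 * (((((F.P K).d + 2) * (F.P K).L : ℕ) : ℝ) * ε₁) + ((((F.P K).d + 2) * (F.P K).L : ℕ) : ℝ) ^ 2 / 4 * δ) *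
      ((F.P K).L : ℝ) ^ ((F.P K).d - 1) < deltaSU (Fin N))
    {α : ℝ} (hαB : ((((F.P K).d + 2) * (F.P K).L : ℕ) : ℝ) ^ 2 / 4 *
      (δ + 4 * max ε₁ (10 * (((((F.P K).d + 2) * (F.P K).L : ℕ) : ℝ) * ε₁) * ((F.P K).L : ℝ) ^ ((F.P K).d - 1))) < α)
    {D : Set (GaugeField (F.P K) (k + 1) (SU N))}
    (hfib : ∀ W ∈ D, (avOfRecord F N K k).avg (crit W) = W) (hcritδ : ∀ W ∈ D, PlaqSmall δ (crit W))
    {ρ : Density (F.P K) k (SU N)}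
    (hρχ : ∀ U, ρ U ≠ 0 → ∀ b : PBond (F.P K) k, ¬ IsB0 b → dist1 ((crit ((avOfRecord F N K k).avg U) b)⁻¹ * U b) < ε₁) :
    ∀ U : GaugeField (F.P K) k (SU N), (avOfRecord F N K k).avg U ∈ D → ρ U ≠ 0 →
      U ∈ interior {W : GaugeField (F.P K) k (SU N) | (∀ c i, dist1 (loopHol W c i) ≤ α) ∧ ∀ p, dist1 (GaugeField.plaqHol W p) ≤
        δ + 4 * max ε₁ (10 * (((((F.P K).d + 2) * (F.P K).L : ℕ) : ℝ) * ε₁) * ((F.P K).L : ℝ) ^ ((F.P K).d - 1))} :=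
  fun U hUD hρ => mem_interior_localSupportSet_of_thresholds crit hk hε hδ hn1 hn2 hαB hfib hcritδ hUD (hρχ U hρ)

/-! ## §3 Editions -/

/-- **BARE EDITION (sanity instance)**: `crit := critCfgOfRecord ν K k`, `D := domAltOfRecord ν K (k+1)`, fibre identity `avg_critCfgOfRecord` and Prop-2 smallness
`hcrit_of_ukExists` (`δ := 2εreg∕L²`) under `hsolν` + the two [B7]-numerics; the threshold clause for the record's β-input `ρ_k = betaInputOfRecord T (chiFixed29 ν ε₁) K g k`
from `betaInput_chi29_pos_iff` ∕ `chiFix29OfRecord_eq_one_iff` — FILE 2's `hρK_betaInputOfRecord_of_hsolν_of_numerics` once more, through §2.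
[cite: Balaban1987RG1, (0.19) p.255, (2.3) p.265, (2.9) p.266 and p.267; Balaban1985Averaging, Prop. 2 (53) p.26] -/
theorem hρK_chi29_bare_of_hsolν (ν : Stage7Numerics) (hk : k < K) (T : Transport F N) (g : ℕ → ℝ) {ε₁ : ℝ} (hε : 0 ≤ ε₁) (hεreg : 0 < ν.εreg)
    (hε3 : (143 * (((((F.P K).d + 4 : ℕ) : ℝ)) ^ 2 / 4) ^ 2) * ν.εreg ≤ 1 / 3)
    (hε2 : 2 * ν.εreg ≤ 2 * deltaSU (Fin N) / ((((F.P K).d + 4) * (F.P K).L : ℕ) : ℝ) ^ 2)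
    (hn1 : 1640 * (2 * (((((F.P K).d + 2) * (F.P K).L : ℕ) : ℝ) * ε₁) + ((((F.P K).d + 2) * (F.P K).L : ℕ) : ℝ) ^ 2 / 4 * (2 * ν.εreg / ((F.P K).L : ℝ) ^ 2)) *
      (((F.P K).L : ℝ) ^ ((F.P K).d - 1)) ^ 2 ≤ 1)
    (hn2 : 13 * (2 * (((((F.P K).d + 2) * (F.P K).L : ℕ) : ℝ) * ε₁) + ((((F.P K).d + 2) * (F.P K).L : ℕ) : ℝ) ^ 2 / 4 * (2 * ν.εreg / ((F.P K).L : ℝ) ^ 2)) *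
      ((F.P K).L : ℝ) ^ ((F.P K).d - 1) < deltaSU (Fin N))
    {α : ℝ} (hαB : ((((F.P K).d + 2) * (F.P K).L : ℕ) : ℝ) ^ 2 / 4 *
      (2 * ν.εreg / ((F.P K).L : ℝ) ^ 2 + 4 * max ε₁ (10 * (((((F.P K).d + 2) * (F.P K).L : ℕ) : ℝ) * ε₁) * ((F.P K).L : ℝ) ^ ((F.P K).d - 1))) < α)
    (hsolν : ∀ W ∈ domAltOfRecord F N ν K (k + 1), UkExists F N K (k + 1) ν.εreg W) :
    ∀ U : GaugeField (F.P K) k (SU N), (avOfRecord F N K k).avg U ∈ domAltOfRecord F N ν K (k + 1) →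
      betaInputOfRecord F N T (chiFixed29 F N ν ε₁) K g k U ≠ 0 →
        U ∈ interior {W : GaugeField (F.P K) k (SU N) | (∀ c i, dist1 (loopHol W c i) ≤ α) ∧ ∀ p, dist1 (GaugeField.plaqHol W p) ≤
          2 * ν.εreg / ((F.P K).L : ℝ) ^ 2 + 4 * max ε₁ (10 * (((((F.P K).d + 2) * (F.P K).L : ℕ) : ℝ) * ε₁) * ((F.P K).L : ℝ) ^ ((F.P K).d - 1))} := by
  have hL0 : (0 : ℝ) < (F.P K).L := by exact_mod_cast (F.P K).L_pos
  have hδ : 0 ≤ 2 * ν.εreg / ((F.P K).L : ℝ) ^ 2 := by positivity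
  refine hρK_of_thresholds (critCfgOfRecord F N ν K k) hk hε hδ hn1 hn2 hαB
    (fun W hW => avg_critCfgOfRecord (hsolν W hW))
    (fun W hW => hcrit_of_ukExists ν hεreg hε3 hε2 (by rw [div_mul_cancel₀ _ (by positivity)]) (hsolν W hW)) ?_
  intro U hρ b hb
  have hpos : 0 < betaInputOfRecord F N T (chiFixed29 F N ν ε₁) K g k U := lt_of_le_of_ne (betaInput_chi29_nonneg ν ε₁ T K g k U) (Ne.symm hρ)
  have hχ := (betaInput_chi29_pos_iff ν ε₁ T K g k U).1 hpos
  have h := (chiFix29OfRecord_eq_one_iff ν ε₁ K k U).1 hχ b hb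
  rwa [fluctDevOfRecord_apply] at h

/-- **[B7] PROP-2 SMALLNESS OF THE OFFER's CRITICAL CONFIGURATION** (the Sel twin of dag-n09-w1 g2's `plaqSmall_critCfgOfRecord_of_ukExists`): for `k < K` and solvable `W`,
`V^{(k),Sel}(W) = M^k(UkSel_{k+1} W)` has `2εreg(L^kη_{k+1})²`-small plaquettes — `UkSel W ∈ bgReg εreg` (K0c∕dag-n09-w4's `isBackground_UkSel`) and dag-n21-c's
`plaqSmall_iter_avOfRecord_level` (Prop 2 (53) at NODE 00's averaging, PROVED). [cite: Balaban1985Averaging, Prop. 2 (53) p.26; Balaban1987RG1, (2.3) p.265] -/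
theorem plaqSmall_critCfgSelOfRecord_of_ukExists (ν : Stage7Numerics) (hk : k < K) (hε : 0 < ν.εreg)
    (hε3 : (143 * (((((F.P K).d + 4 : ℕ) : ℝ)) ^ 2 / 4) ^ 2) * ν.εreg ≤ 1 / 3)
    (hε2 : 2 * ν.εreg ≤ 2 * deltaSU (Fin N) / ((((F.P K).d + 4) * (F.P K).L : ℕ) : ℝ) ^ 2)
    {W : GaugeField (F.P K) (k + 1) (SU N)} (hW : UkExists F N K (k + 1) ν.εreg W) :
    PlaqSmall (2 * ν.εreg * (((F.P K).L : ℝ) ^ k * (F.P K).eta (k + 1)) ^ 2) (critCfgSelOfRecord F N ν K k W) := by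
  have hk1 : k + 1 ≤ (F.P K).m + (F.P K).K := by simp only [T4Continuum.T4Family.P_K]; omega
  rw [critCfgSelOfRecord_def]
  exact plaqSmall_iter_avOfRecord_level K (k + 1) hε hε3 hε2 ((mem_bgReg_iff F N K (k + 1) ν.εreg _).1 (isBackground_UkSel hk1 hW).2.1) (Nat.le_succ k)

/-- **… in the threshold lemma's shape**: `PlaqSmall δ (critCfgSelOfRecord ν K k W)` for every solvable `W` and every `δ` with `2εreg ≤ δ·L²` (the Sel twin of dag-n09-w1 g2's
`hcrit_of_ukExists`; `(L^kη_{k+1})² ≤ L^{−2}`). [cite: Balaban1985Averaging, Prop. 2 (53) p.26; Balaban1987RG1, (2.3) p.265 and (2.9) p.266] -/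
theorem hcritSel_of_ukExists (ν : Stage7Numerics) (hk : k < K) {δ : ℝ} (hε : 0 < ν.εreg)
    (hε3 : (143 * (((((F.P K).d + 4 : ℕ) : ℝ)) ^ 2 / 4) ^ 2) * ν.εreg ≤ 1 / 3)
    (hε2 : 2 * ν.εreg ≤ 2 * deltaSU (Fin N) / ((((F.P K).d + 4) * (F.P K).L : ℕ) : ℝ) ^ 2) (hδ : 2 * ν.εreg ≤ δ * ((F.P K).L : ℝ) ^ 2)
    {W : GaugeField (F.P K) (k + 1) (SU N)} (hW : UkExists F N K (k + 1) ν.εreg W) : PlaqSmall δ (critCfgSelOfRecord F N ν K k W) := by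
  have h := plaqSmall_critCfgSelOfRecord_of_ukExists ν hk hε hε3 hε2 hW
  have hL0 : (0 : ℝ) < (F.P K).L := by have := (F.P K).L_pos; exact_mod_cast this
  have hη0 : 0 ≤ ((F.P K).L : ℝ) ^ k * (F.P K).eta (k + 1) := by unfold Params.eta; positivity
  have hsq : (((F.P K).L : ℝ) ^ k * (F.P K).eta (k + 1)) ^ 2 ≤ (((F.P K).L : ℝ)⁻¹) ^ 2 :=
    pow_le_pow_left₀ hη0 (pow_mul_eta_le_inv (Nat.lt_succ_self k)) 2
  have hbound : 2 * ν.εreg * (((F.P K).L : ℝ) ^ k * (F.P K).eta (k + 1)) ^ 2 ≤ δ := by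
    calc 2 * ν.εreg * (((F.P K).L : ℝ) ^ k * (F.P K).eta (k + 1)) ^ 2 ≤ 2 * ν.εreg * (((F.P K).L : ℝ)⁻¹) ^ 2 := by gcongr
      _ = 2 * ν.εreg / ((F.P K).L : ℝ) ^ 2 := by rw [inv_pow, div_eq_mul_inv]
      _ ≤ δ := by rw [div_le_iff₀ (by positivity)]; exact hδ
  exact fun p => (h p).trans_le hbound

/-- ★★ **Sel EDITION (the OFFER)**: `crit := critCfgSelOfRecord ν K k = M^k ∘ UkSel`, `ρ_k := betaInputOfRecord T (chiFixed29Sel ν ε₁) K g k` (K0c∕dag-n09-w4 g2's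
`Node00.SmallFieldChi29SelOfRecord`), `D := domAltOfRecord ν K (k+1)`: the fibre identity is `avg_critCfgSelOfRecord` under `hsolν`; the Prop-2 smallness
`PlaqSmall δ (critCfgSelOfRecord ν K k W)` on the domain is DISPLAYED (the Sel hierarchy lemmas display the same `hcrit`); then FILE 3's `hρK` for the Sel β-input from numerics.
NO record reads these objects yet. [cite: Balaban1987RG1, (0.19) p.255, (2.3) p.265, (2.9) p.266 and p.267; Balaban1985Variational, Thm 1 p.279] -/
theorem hρK_betaInput_chi29Sel_of_fibre_of_plaqSmall (ν : Stage7Numerics) (hk : k < K) (T : Transport F N) (g : ℕ → ℝ) {ε₁ δ : ℝ} (hε : 0 ≤ ε₁) (hδ : 0 ≤ δ)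
    (hn1 : 1640 * (2 * (((((F.P K).d + 2) * (F.P K).L : ℕ) : ℝ) * ε₁) + ((((F.P K).d + 2) * (F.P K).L : ℕ) : ℝ) ^ 2 / 4 * δ) *
      (((F.P K).L : ℝ) ^ ((F.P K).d - 1)) ^ 2 ≤ 1)
    (hn2 : 13 * (2 * (((((F.P K).d + 2) * (F.P K).L : ℕ) : ℝ) * ε₁) + ((((F.P K).d + 2) * (F.P K).L : ℕ) : ℝ) ^ 2 / 4 * δ) *
      ((F.P K).L : ℝ) ^ ((F.P K).d - 1) < deltaSU (Fin N))
    {α : ℝ} (hαB : ((((F.P K).d + 2) * (F.P K).L : ℕ) : ℝ) ^ 2 / 4 *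
      (δ + 4 * max ε₁ (10 * (((((F.P K).d + 2) * (F.P K).L : ℕ) : ℝ) * ε₁) * ((F.P K).L : ℝ) ^ ((F.P K).d - 1))) < α)
    (hsolν : ∀ W ∈ domAltOfRecord F N ν K (k + 1), UkExists F N K (k + 1) ν.εreg W)
    (hcritδ : ∀ W ∈ domAltOfRecord F N ν K (k + 1), PlaqSmall δ (critCfgSelOfRecord F N ν K k W)) :
    ∀ U : GaugeField (F.P K) k (SU N), (avOfRecord F N K k).avg U ∈ domAltOfRecord F N ν K (k + 1) →
      betaInputOfRecord F N T (chiFixed29Sel F N ν ε₁) K g k U ≠ 0 →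
        U ∈ interior {W : GaugeField (F.P K) k (SU N) | (∀ c i, dist1 (loopHol W c i) ≤ α) ∧ ∀ p, dist1 (GaugeField.plaqHol W p) ≤
          δ + 4 * max ε₁ (10 * (((((F.P K).d + 2) * (F.P K).L : ℕ) : ℝ) * ε₁) * ((F.P K).L : ℝ) ^ ((F.P K).d - 1))} := by
  have hj : k + 1 ≤ (F.P K).m + (F.P K).K := by simp only [T4Continuum.T4Family.P_K]; omega
  refine hρK_of_thresholds (critCfgSelOfRecord F N ν K k) hk hε hδ hn1 hn2 hαB
    (fun W hW => avg_critCfgSelOfRecord hj (hsolν W hW)) hcritδ ?_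
  intro U hρ b hb
  -- `ρ U ≠ 0` ⇒ `χ^{(2.9),Sel}_k(U) = 1` ⇒ the thresholds
  have hχne : chiFix29SelOfRecord F N ν ε₁ K k U ≠ 0 := by
    intro h0
    apply hρ
    show chiFixed29Sel F N ν ε₁ K g k U * Real.exp (-(1 / (g k) ^ 2) * gfOfRecord F N K k U +
      effActionHT F N T (chiFixed29Sel F N ν ε₁) K g k U) = 0
    rw [chiFixed29Sel_apply, h0, zero_mul]
  have hχ : chiFix29SelOfRecord F N ν ε₁ K k U = 1 := by
    rcases chiFix29SelOfRecord_eq_zero_or_one ν ε₁ K k U with h | h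
    · exact absurd h hχne
    · exact h
  have h := (chiFix29SelOfRecord_eq_one_iff ν ε₁ K k U).1 hχ b hb
  rwa [fluctDevSelOfRecord_apply] at h

/-- ★★★ **Sel EDITION FROM `hsolν` + NUMERICS ONLY** (`δ := 2εreg∕L²`, Prop-2 smallness by `hcritSel_of_ukExists`): FILE 3's local support clause `hρK` for the Sel β-input
`ρ_k = betaInputOfRecord T (chiFixed29Sel ν ε₁) K g k` at `D := domAltOfRecord ν K (k+1)` — the exact Sel twin of FILE 2's `hρK_betaInputOfRecord_of_hsolν_of_numerics` (one step `k`).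
[cite: Balaban1987RG1, (0.19) p.255, (2.3) p.265, (2.9) p.266 and p.267; Balaban1985Averaging, Prop. 2 (53) p.26] -/
theorem hρK_betaInput_chi29Sel_of_hsolν_of_numerics (ν : Stage7Numerics) (hk : k < K) (T : Transport F N) (g : ℕ → ℝ) {ε₁ : ℝ} (hε : 0 ≤ ε₁)
    (hεreg : 0 < ν.εreg)
    (hε3 : (143 * (((((F.P K).d + 4 : ℕ) : ℝ)) ^ 2 / 4) ^ 2) * ν.εreg ≤ 1 / 3)
    (hε2 : 2 * ν.εreg ≤ 2 * deltaSU (Fin N) / ((((F.P K).d + 4) * (F.P K).L : ℕ) : ℝ) ^ 2)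
    (hn1 : 1640 * (2 * (((((F.P K).d + 2) * (F.P K).L : ℕ) : ℝ) * ε₁) + ((((F.P K).d + 2) * (F.P K).L : ℕ) : ℝ) ^ 2 / 4 * (2 * ν.εreg / ((F.P K).L : ℝ) ^ 2)) *
      (((F.P K).L : ℝ) ^ ((F.P K).d - 1)) ^ 2 ≤ 1)
    (hn2 : 13 * (2 * (((((F.P K).d + 2) * (F.P K).L : ℕ) : ℝ) * ε₁) + ((((F.P K).d + 2) * (F.P K).L : ℕ) : ℝ) ^ 2 / 4 * (2 * ν.εreg / ((F.P K).L : ℝ) ^ 2)) *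
      ((F.P K).L : ℝ) ^ ((F.P K).d - 1) < deltaSU (Fin N))
    {α : ℝ} (hαB : ((((F.P K).d + 2) * (F.P K).L : ℕ) : ℝ) ^ 2 / 4 *
      (2 * ν.εreg / ((F.P K).L : ℝ) ^ 2 + 4 * max ε₁ (10 * (((((F.P K).d + 2) * (F.P K).L : ℕ) : ℝ) * ε₁) * ((F.P K).L : ℝ) ^ ((F.P K).d - 1))) < α)
    (hsolν : ∀ W ∈ domAltOfRecord F N ν K (k + 1), UkExists F N K (k + 1) ν.εreg W) :
    ∀ U : GaugeField (F.P K) k (SU N), (avOfRecord F N K k).avg U ∈ domAltOfRecord F N ν K (k + 1) →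
      betaInputOfRecord F N T (chiFixed29Sel F N ν ε₁) K g k U ≠ 0 →
        U ∈ interior {W : GaugeField (F.P K) k (SU N) | (∀ c i, dist1 (loopHol W c i) ≤ α) ∧ ∀ p, dist1 (GaugeField.plaqHol W p) ≤
          2 * ν.εreg / ((F.P K).L : ℝ) ^ 2 + 4 * max ε₁ (10 * (((((F.P K).d + 2) * (F.P K).L : ℕ) : ℝ) * ε₁) * ((F.P K).L : ℝ) ^ ((F.P K).d - 1))} :=
  have hL0 : (0 : ℝ) < (F.P K).L := by exact_mod_cast (F.P K).L_pos
  hρK_betaInput_chi29Sel_of_fibre_of_plaqSmall ν hk T g hε (by positivity) hn1 hn2 hαB hsolν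
    fun W hW => hcritSel_of_ukExists ν hk hεreg hε3 hε2 (by rw [div_mul_cancel₀ _ (by positivity)]) (hsolν W hW)

end Summit.QuantumFields.YangMills.BalabanUVNodes.N09LocalSupportSetAnyCrit

end
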